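import Summits.Ventures.YMGap.RobustBall.IsotropicPairWitness
import HarnessLib

/-!
# Venture YMGap, track ROBUST-BALL (tier 2) — gauge invariance of the exhibited infinite-range members

HONEST FRAMING. WHAT THIS IS: a venture file (cell `pub-ymgap`, track Y2 ROBUST-BALL, seat rb-p1) recording, in
the kernel rather than in prose, that every term of the exhibited tier-2 members is GAUGE INVARIANT on `ℤ^d`
(`IsZdGaugeInvariant`, Seiler LNP 159 Ch. 1): the normalised plaquette trace `plaqObsN`, the axial pair term
`axialTerm`, the general two-plaquette term `plaqPairTerm`, and hence — termwise, for every link set `X` — the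
potentials `axialPairWitness N τ κ`, `plaqPairCoupling N J`, `isotropicPairWitness N τ κ` (finite sums of
invariant terms; generic `isZdGaugeInvariant_indexedPotential`). WHAT IT IS NOT: no measure, no estimate,
no number; nothing about the continuum limit or the Clay problem.

References: tree `isZdGaugeInvariant_plaquetteObs` (cyclicity of the trace).
-/

noncomputable section

open MeasureTheory Filter Function Topology Real
open Literature.Probability.LatticeModels
open Literature.MathematicalPhysics.QuantumLattice
open Literature.MathematicalPhysics.QuantumFieldTheory hiding ZdEdge

namespace Summit.Ventures.YMGap.RobustBall

variable {d N : ℕ} {ι : Type*}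

/-- A finite sum of gauge-invariant terms is gauge invariant: every term of an indexed potential with
gauge-invariant terms is gauge invariant. -/
theorem isZdGaugeInvariant_indexedPotential {fib : Finset (ZdEdge d) → Finset ι}
    {φ : ι → LGConfig d (Matrix.specialUnitaryGroup (Fin N) ℂ) → ℝ} (h : ∀ i, IsZdGaugeInvariant (φ i))
    (X : Finset (ZdEdge d)) : IsZdGaugeInvariant (indexedPotential fib φ X) := fun g U => by
  simp only [indexedPotential_apply]
  exact Finset.sum_congr rfl fun i _ => h i g U

/-- The normalised plaquette trace `Re tr U_p / N` is gauge invariant. -/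
theorem isZdGaugeInvariant_plaqObsN (p : ZdPlaquette d) : IsZdGaugeInvariant (plaqObsN (d := d) N p) := fun g U => by
  unfold plaqObsN
  rw [isZdGaugeInvariant_plaquetteObs (fundamentalRep (Fin N)) p.1 p.2.1.1 p.2.1.2 g U]

/-- The axial pair term is gauge invariant. -/
theorem isZdGaugeInvariant_axialTerm (τ κ : ℝ) (i : AxialIdx d) :
    IsZdGaugeInvariant (axialTerm (d := d) N τ κ i) := fun g U => by
  unfold axialTerm
  rw [isZdGaugeInvariant_plaqObsN i.1 g U, isZdGaugeInvariant_plaqObsN (partner i) g U]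

/-- The general two-plaquette term is gauge invariant. -/
theorem isZdGaugeInvariant_plaqPairTerm (J : PlaqPairIdx d → ℝ) (i : PlaqPairIdx d) :
    IsZdGaugeInvariant (plaqPairTerm (d := d) N J i) := fun g U => by
  unfold plaqPairTerm
  rw [isZdGaugeInvariant_plaqObsN i.1 g U, isZdGaugeInvariant_plaqObsN i.2 g U]

/-- **Every term of the axial-pair witness is gauge invariant.** -/
theorem isZdGaugeInvariant_axialPairWitness (τ κ : ℝ) (X : Finset (ZdEdge d)) :
    IsZdGaugeInvariant (axialPairWitness (d := d) N τ κ X) :=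
  isZdGaugeInvariant_indexedPotential (isZdGaugeInvariant_axialTerm τ κ) X

/-- **Every term of a two-plaquette coupling potential is gauge invariant.** -/
theorem isZdGaugeInvariant_plaqPairCoupling (J : PlaqPairIdx d → ℝ) (X : Finset (ZdEdge d)) :
    IsZdGaugeInvariant (plaqPairCoupling (d := d) N J X) :=
  isZdGaugeInvariant_indexedPotential (isZdGaugeInvariant_plaqPairTerm J) X

/-- **Every term of the isotropic member is gauge invariant.** -/
theorem isZdGaugeInvariant_isotropicPairWitness (τ κ : ℝ) (X : Finset (ZdEdge d)) :
    IsZdGaugeInvariant (isotropicPairWitness (d := d) N τ κ X) :=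
  isZdGaugeInvariant_plaqPairCoupling (isoJ τ κ) X

end Summit.Ventures.YMGap.RobustBall
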